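import Summits.BirchSwinnertonDyer.Rank1Residual.X11b.AnticyclotomicRamifiedPlaces
import Literature.NumberTheory.EllipticCurves.QuadraticTwistRamifiedLocalPolynomialProofs
import Literature.NumberTheory.EllipticCurves.GaloisAction
import Literature.NumberTheory.GaloisRepresentations.AbsGaloisOuterConj
import Literature.NumberTheory.QuadraticFields.ConjugateIdealClass
import HarnessLib

/-!
# Route `GenusKolyvaginAtTwo`, crux 23491 `GenusDeepSupplyAtTwoNegDiscNarrow` (and its Δ>0 twin 25504), registered stub C‴:
# THE DEPTH-ZERO REDUCTION CRITERION, INSTANTIATED (I) — the inertia element at a prime ramified in the quadratic field, and the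
# `E(K) ↪ E(ℚ̄)` plumbing

Seat `bsd-line-gk2-p5` g33 (cell `bsd-f1-sign2`, WIDTH-5 attach), `--supports stmt-BirchSwinnertonDyer-23491 --as helper`.
THEOREMS ONLY (no definition, no named fact, no `sorry`).  **BSD is NOT proved by this file and no item is closed by it; the registered
stub C‴ is untouched.**

WHAT.  The LEAD's kernel `GenusSupplyNarrow.geomReduction_eq_of_two_smul_of_inertia_anti` (p761607, memo
`DEPTH-ZERO-REDUCTION-CRITERION-g21.md` §2) is stated for an abstract inertia element `γ ∈ I_𝔓 ≤ Γ_ℚ` and an abstract `γ`-stable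
`2`-torsion-free subgroup `A ≤ E(ℚ̄)`; its module docstring leaves open «the existence of such `γ` (an element of `I(𝔓 ∣ ℓ₀) ≤ Γ_ℚ`
restricting to `τ` on `K` when `ℓ₀ ∣ d_K`) and the instantiation plumbing».  This file supplies the two field-theoretic pieces
(the sequel `…DepthZeroInstance` assembles the criterion in the cruxes' currency):

* §1 **the inertia element** (`exists_mem_inertia_smul_absEmbedding_eq`): for a quadratic field `K` and a prime `ℓ ∣ d_K`, every prime
  `𝔓` of `\bar ℤ` above `ℓ` carries some `γ ∈ I_𝔓(Γ_ℚ)` acting on the embedded copy `e(K) ⊂ ℚ̄` (`e = absEmbedding ℚ K`) through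
  the non-trivial automorphism `τ` of `K` — Hilbert theory «`I(𝔓 ∣ ℓ) ↠ I(𝔭 ∣ ℓ) = Gal(K/ℚ)`» (the tree's quadratic trichotomy
  `placesOver_trichotomy_of_finrank_eq_two`, Dedekind's discriminant theorem `exists_place_ramificationIdx_ne_one_of_dvd_discr`, X11b's
  `exists_mem_inertia_not_mem_range_of_ramificationIdx_eq_two`, read through `absGaloisQuot` / `absGaloisQuot_eq_one_iff`);
* §2 **the plumbing**: `γ • e_* P = e_* (τ • P)` for `e_* = Affine.Point.map e : E(K) → E(ℚ̄)` (`smul_eq_map_absEmbedding_smul`, both actions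
  being coordinatewise), and a small group lemma (odd order of torsion inside a `2`-torsion-free subgroup).

References: [NeukirchANT1999] Ch. I §9 (9.4)–(9.6), Ch. III (2.6), (2.12); [SilvermanAEC2009] VIII.§1.
-/

set_option autoImplicit false
set_option linter.dupNamespace false -- `Summit.<P>.<Sub>` repeats `BirchSwinnertonDyer` (D-0017)

noncomputable section

open scoped Classical NumberField Pointwise

namespace Summit.BirchSwinnertonDyer.BirchSwinnertonDyer.Theorems.GenusSupplyNarrow.DepthZero

open IsDedekindDomain Field NumberField WeierstrassCurve Literature.NumberTheory.EllipticCurves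
  Literature.NumberTheory.GaloisRepresentations Rat.HeightOneSpectrum

variable {K : Type} [Field K] [NumberField K]

/-! ## §1 The inertia element at a prime of `\bar ℤ` over a prime ramified in the quadratic field -/

/-- **At a prime `𝔓` of `\bar ℤ` over a prime `ℓ` RAMIFIED in the quadratic field `K` (`ℓ ∣ d_K`), the inertia group `I_𝔓(Γ_ℚ)` is not
contained in `res(Γ_K)`** («`I(𝔓 ∣ ℓ)` surjects onto `I(𝔭 ∣ ℓ) = Gal(K/ℚ)`»).  Dedekind's discriminant theorem gives a place `w ∣ ℓ` of
`K` with `e ≠ 1` (`exists_place_ramificationIdx_ne_one_of_dvd_discr`); by the quadratic trichotomy (`placesOver_trichotomy_of_finrank_eq_two`)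
it is the only place above `ℓ` and `e(w ∣ ℓ) = 2`; `𝔓 = ι⁻¹𝔔` for a prime `𝔔` of `\bar ℤ_K` (`exists_isPrime_comap_absIntegersMap_eq`),
necessarily above `w`; then X11b's `exists_mem_inertia_not_mem_range_of_ramificationIdx_eq_two`.
[cite: NeukirchANT1999, Ch. I §9 Prop. (9.4)–(9.6); Ch. III Thm. (2.6), Cor. (2.12)] -/
theorem exists_mem_inertia_not_mem_range_of_dvd_discr (h2 : Module.finrank ℚ K = 2)
    {ℓ : ℕ} [Fact ℓ.Prime] (hℓ : (ℓ : ℤ) ∣ NumberField.discr K)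
    {v : HeightOneSpectrum (𝓞 ℚ)} (hv : (primesEquiv v : ℕ) = ℓ)
    {𝔓 : Ideal (absIntegers (𝓞 ℚ) ℚ)} (h𝔓 : 𝔓 ∈ v.primesAbove) :
    ∃ γ ∈ 𝔓.inertia (absoluteGaloisGroup ℚ), γ ∉ Set.range (absGaloisRestrict ℚ K) := by
  haveI : FiniteDimensional ℚ K := Module.finite_of_finrank_eq_succ h2
  haveI : 𝔓.IsPrime := h𝔓.1
  -- the ramified place `w` of `K` above `v`
  have hdvd : ((primesEquiv v : ℕ) : ℤ) ∣ NumberField.discr K := by rw [hv]; exact hℓ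
  obtain ⟨w, hwv, hne⟩ := WeierstrassCurve.exists_place_ramificationIdx_ne_one_of_dvd_discr K v hdvd
  have hw : w.under (𝓞 ℚ) = v := HeightOneSpectrum.ext hwv
  obtain ⟨hset, he⟩ : {w' : HeightOneSpectrum (𝓞 K) | w'.under (𝓞 ℚ) = v} = {w} ∧
      w.asIdeal.ramificationIdx (𝓞 ℚ) = 2 := by
    rcases placesOver_trichotomy_of_finrank_eq_two K h2 v with
      ⟨w₁, w₂, -, -, hall⟩ | ⟨w₀, hS, he1, -⟩ | ⟨w₀, hS, he2, -⟩
    · exact absurd (hall w hw).1 hne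
    · have : w = w₀ := by simpa using (show w ∈ ({w₀} : Set _) by rw [← hS]; exact hw)
      subst this; exact absurd he1 hne
    · have : w = w₀ := by simpa using (show w ∈ ({w₀} : Set _) by rw [← hS]; exact hw)
      subst this; exact ⟨hS, he2⟩
  -- a prime `𝔔` of `\bar ℤ_K` with `ι⁻¹ 𝔔 = 𝔓`; it lies above `w`
  obtain ⟨𝔔, h𝔔p, h𝔔⟩ := exists_isPrime_comap_absIntegersMap_eq ℚ K 𝔓
  haveI := h𝔔p
  obtain ⟨w', hw'v, hw'𝔔, -⟩ :=
    exists_heightOneSpectrum_of_comap_absIntegersMap_mem_primesAbove (K := ℚ) (M := K) (𝔔 := 𝔔) (h𝔔 ▸ h𝔓)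
  have hw' : w' = w := by
    have : w' ∈ ({w' : HeightOneSpectrum (𝓞 K) | w'.under (𝓞 ℚ) = v}) := HeightOneSpectrum.ext hw'v
    rw [hset] at this
    exact this
  subst hw'
  obtain ⟨y, hyI, hy⟩ :=
    Summit.BirchSwinnertonDyer.Rank1Residual.X11b.AcSelmer.exists_mem_inertia_not_mem_range_of_ramificationIdx_eq_two
      h2 he hw'𝔔
  rw [h𝔔] at hyI
  exact ⟨y, hyI, hy⟩

/-- **THE INERTIA ELEMENT.**  `K` quadratic, `ℓ ∣ d_K`, `𝔓` a prime of `\bar ℤ` above `ℓ`: there are `γ ∈ I_𝔓(Γ_ℚ)` and the non-trivial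
`τ ∈ Aut(K/ℚ)` with **`γ • e(x) = e(τ x)`** for all `x ∈ K`, `e = absEmbedding ℚ K : K → ℚ̄` the tree's chosen copy of `K` in `ℚ̄`
(«an inertia element at `𝔓 ∣ ℓ` restricting to complex conjugation on `K = ℚ(√d_K)`, `d_K < 0`»).  From §1's element outside
`res(Γ_K) = ker (Γ_ℚ → Gal(K/ℚ))` (`absGaloisQuot_eq_one_iff`, `absEmbedding_absGaloisQuot_apply`).
[cite: NeukirchANT1999, Ch. I §9 Prop. (9.4)–(9.6)] -/
theorem exists_mem_inertia_smul_absEmbedding_eq (h2 : Module.finrank ℚ K = 2)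
    {ℓ : ℕ} [Fact ℓ.Prime] (hℓ : (ℓ : ℤ) ∣ NumberField.discr K)
    {v : HeightOneSpectrum (𝓞 ℚ)} (hv : (primesEquiv v : ℕ) = ℓ)
    {𝔓 : Ideal (absIntegers (𝓞 ℚ) ℚ)} (h𝔓 : 𝔓 ∈ v.primesAbove) :
    ∃ γ ∈ 𝔓.inertia (absoluteGaloisGroup ℚ), ∃ τ : K ≃ₐ[ℚ] K, τ ≠ 1 ∧
      ∀ x : K, γ • absEmbedding ℚ K x = absEmbedding ℚ K (τ x) := by
  haveI : Algebra.IsQuadraticExtension ℚ K := ⟨h2⟩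
  haveI : IsGalois ℚ K := inferInstance
  obtain ⟨γ, hγI, hγ⟩ := exists_mem_inertia_not_mem_range_of_dvd_discr h2 hℓ hv h𝔓
  refine ⟨γ, hγI, absGaloisQuot ℚ K γ, fun h1 ↦ hγ ?_, fun x ↦ ?_⟩
  · exact (absGaloisQuot_eq_one_iff ℚ K γ).mp h1
  · rw [absEmbedding_absGaloisQuot_apply]

/-! ## §2 Plumbing: `E(K) ↪ E(ℚ̄)` along `e`, equivariance, two small group lemmas -/

/-- **Equivariance of `e_* : E(K) → E(ℚ̄)`** (coordinate form): if `γ ∈ Γ_ℚ` acts on `e(K)` through `τ ∈ Aut(K/ℚ)`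
(`γ • e x = e (τ x)`), then applying `γ` to the coordinates of `e_* P` gives `e_* (τ • P)`, for every `P ∈ E(K)`.
[cite: SilvermanAEC2009, VIII.§1] -/
theorem map_toAlgEquiv_map_absEmbedding (W : WeierstrassCurve ℚ) {γ : absoluteGaloisGroup ℚ} {τ : K ≃ₐ[ℚ] K}
    (hγ : ∀ x : K, γ • absEmbedding ℚ K x = absEmbedding ℚ K (τ x)) (P : (W.baseChange K).toAffine.Point) :
    Affine.Point.map (W' := W) (absoluteGaloisGroup.toAlgEquiv ℚ γ).toAlgHom
        (Affine.Point.map (W' := W) (absEmbedding ℚ K) P) =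
      Affine.Point.map (W' := W) (absEmbedding ℚ K) (τ • P) := by
  have hcomp : (absoluteGaloisGroup.toAlgEquiv ℚ γ).toAlgHom.comp (absEmbedding ℚ K) =
      (absEmbedding ℚ K).comp (τ : K →ₐ[ℚ] K) := AlgHom.ext fun x ↦ hγ x
  rw [WeierstrassCurve.smul_def W K τ P, Affine.Point.map_map, Affine.Point.map_map, hcomp]

/-- **Equivariance of `e_* : E(K) → E(ℚ̄) = W.geomPoints`** for the `Γ_ℚ`-action on geometric points: `γ • e_* P = e_* (τ • P)` whenever
`γ • e x = e (τ x)` on `K` (the `Γ_ℚ`-action on `E(ℚ̄)` is the coordinate action, `WeierstrassCurve.smul_def`). [cite: SilvermanAEC2009, VIII.§1] -/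
theorem smul_eq_map_absEmbedding_smul (W : WeierstrassCurve ℚ) {γ : absoluteGaloisGroup ℚ} {τ : K ≃ₐ[ℚ] K}
    (hγ : ∀ x : K, γ • absEmbedding ℚ K x = absEmbedding ℚ K (τ x)) (P : (W.baseChange K).toAffine.Point)
    (Y : W.geomPoints) (hY : Y = Affine.Point.map (W' := W) (absEmbedding ℚ K) P) :
    γ • Y = Affine.Point.map (W' := W) (absEmbedding ℚ K) (τ • P) := by
  subst hY
  exact map_toAlgEquiv_map_absEmbedding W hγ P

/-- In an additive commutative group, a point of finite order all of whose multiples `u` satisfy `2 • u = 0 → u = 0` has ODD order.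
[folklore] -/
theorem odd_addOrderOf_of_two_torsionFree {A : Type*} [AddCommGroup A] {t : A} (ht : IsOfFinAddOrder t)
    (h2 : ∀ k : ℕ, (2 : ℤ) • (k • t) = 0 → k • t = 0) : Odd (addOrderOf t) := by
  rcases Nat.even_or_odd (addOrderOf t) with ⟨k, hk⟩ | hodd
  · exfalso
    have hpos := ht.addOrderOf_pos
    have hkt : k • t = 0 := by
      refine h2 k ?_
      rw [two_smul, ← add_nsmul, ← hk]
      exact addOrderOf_nsmul_eq_zero t
    have hdvd := addOrderOf_dvd_of_nsmul_eq_zero hkt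
    have hk0 : 0 < k := by omega
    have := Nat.le_of_dvd hk0 hdvd
    omega
  · exact hodd

end Summit.BirchSwinnertonDyer.BirchSwinnertonDyer.Theorems.GenusSupplyNarrow.DepthZero

end
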